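import Literature.NumberTheory.EllipticCurves.CastellaGrossiSkinner2025.AnticyclotomicMainConjectures
import Literature.NumberTheory.EllipticCurves.BurungaleCastellaSkinner2025.HeegnerPointMainConjecture
import Literature.NumberTheory.EllipticCurves.MazurTorsionGaloisStructureProofs
import HarnessLib

/-!
# Burungale–Castella–Skinner 2025, Theorem 4.2.1 (a) FROM Castella–Grossi–Skinner 2025, Theorem 6.5.2
# on the locus `p ∤ D_K` — a PROVED cross-paper edge between two named facts (no new fact)

PROOF-ONLY file (typing layer D-0088(4), seat `bsd-littype-03`, gen 2; nothing asserted, 0 named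
facts, D-0026 net debt 0). It records in the kernel the printed proof pointer of BCS 2025, Thm. 4.2.1
(a): "Part (a) is contained in [CGS23, Thm. 5.5.2]" (`[corpus: paper:arxiv-2405.00270 p0008 L112]`),
[CGS23, Thm. 5.5.2] = Castella–Grossi–Skinner, Math. Ann. 393 (2025), Thm. 6.5.2 = tree fact
`CastellaGrossiSkinner2025.thm652_rankOne_charIdeal_torsion_eq_sq_dvd` (seat `bsd-littype-02`,
`CastellaGrossiSkinner2025/AnticyclotomicMainConjectures.lean`), whose §6 standing hypotheses include
"`K` … of discriminant `D_K` prime to `Np`" (`[corpus: paper:arxiv-2303.04373 p0020 L10]`) and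
(h1) `E(K)[p] = 0` — the LOCATED CITATION GAP "F3" of `run/shared/lean/pub/bsd-littype/STATUS.md`
(2026-08-26T17:45:36Z, seat bsd-littype-02): BCS state Thm. 4.2.1 (a) under (disc), (Heeg), (irr_K),
`p` odd good ordinary, WITHOUT `p ∤ D_K`, so on the slice `p ∣ D_K` the printed pointer does not
apply. This file proves exactly what the pointer gives:

* `thm421a_of_thm652_of_not_dvd_discr`: **`thm652_… → p ∤ D_K → thm421a_…`** — on the locus
  `p ∤ D_K` the BCS fact (rational Heegner-point divisibility `c · ch(H¹_{F_Λ}/(κ₁^{Heeg}))² ⊆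
  ch(X^ord(E/K_∞⁻)_tor)`, `c ≠ 0`) is a COROLLARY of the CGS fact (`ch(X_tor) = J²`,
  `J ∣ p^k · ch(𝔖/Λκ₁^{Hg})`): take `c = p^{2k}`, since `(p^k ch(𝔖/Λκ₁))² = J²·A² ⊆ J² = ch(X_tor)`;
* the one hypothesis of Thm. 6.5.2 that Thm. 4.2.1's do not list verbatim, (h1) `E(K)[p] = 0`, is
  DERIVED from (irr_K) — `WeierstrassCurve.HasIrreducibleModPGaloisRep.eq_zero_of_prime_smul_eq_zero`:
  over a perfect field `F` with `p ≠ char F`, an `F`-rational point of order `p` spans a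
  `Γ_F`-stable line of `E[p]`, so `ρ̄_{E,p}` is reducible (the tree had this over `ℚ` only,
  `not_exists_addOrderOf_eq_of_hasIrreducibleModPGaloisRep`, `MazurTorsionGaloisStructureProofs.lean`;
  here its two `ℚ`-specific lines are repeated over `F` — `exists_geomTorsion_fixed_of_addOrderOf_eq`,
  `not_hasIrreducibleModPGaloisRep_of_rational_addOrderOf_eq`). This also discharges the hypothesis
  `h1` of `CastellaGrossiSkinner2025.Thm652Hypotheses.of_thmCHypotheses` wherever (irr_K) is available
  (`thm652Hypotheses_of_irr`).

Consequence for the cell's sheets: on `p ∤ D_K` (in particular under (spl), where `p` is unramified)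
`thm421a_…` carries no independent debt — it follows from `thm652_…`; only the slice `p ∣ D_K`
(`p` odd good ordinary, ramified in `K`, (disc) (Heeg) (irr_K)) rests on BCS's statement alone.

## References
* [BurungaleCastellaSkinner2025] IMRN 2025 rnaf082 = arXiv:2405.00270v2, Thm. 4.2.1 (a) and its
  proof line (p. 8).
* [CastellaGrossiSkinner2025] Math. Ann. 393 (2025), Thm. 6.5.2 (= arXiv v1 Thm. 5.5.2) with the §6
  standing hypotheses.
* [Mazur1977] B. Mazur, Publ. Math. IHÉS 47 (1977), Ch. III §5, p. 157 (a rational point of order `N`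
  makes `ρ̄_{E,N}` of Borel shape) — tree `MazurTorsionGaloisStructureProofs.lean`.
-/

noncomputable section

open scoped Classical

open WeierstrassCurve NumberField IsDedekindDomain Field
  Literature.NumberTheory.EllipticCurves Literature.NumberTheory.EllipticCurves.Rank1Residual

universe u

/-! ## §1 A rational point of prime order makes `ρ̄_{E,p}` reducible (any perfect base field) -/

namespace Literature.NumberTheory.EllipticCurves

section AnyField

variable {F : Type u} [Field F] (W : WeierstrassCurve F)

/-- **The geometric point of an `F`-rational point of prime order `N`** lies in `E[N] = E(F̄)[N]`, is
non-zero and is fixed by `Γ_F` (the image of `P` under `E(F) → E(F̄)`, Mathlib's `Affine.Point.map`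
along `F → F̄`). The tree's `exists_geomTorsion_of_addOrderOf_eq` is the case `F = ℚ`; the proof is
the same. [cite: Mazur1977, Ch. III §5, p. 157 ("ℤ/N ⊂ E[N]")] -/
theorem exists_geomTorsion_fixed_of_addOrderOf_eq {N : ℕ} [Fact N.Prime] {P : W.toAffine.Point}
    (hP : addOrderOf P = N) :
    ∃ Pb : geomTorsion W N,
      (Pb : geomPoints W) = Affine.Point.map (W' := W.toAffine) (S := F)
        (Algebra.ofId F (AlgebraicClosure F)) P ∧
      Pb ≠ 0 ∧ ∀ σ : absoluteGaloisGroup F, σ • Pb = Pb := by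
  have hN : N.Prime := Fact.out
  set ι : W.toAffine.Point →+ geomPoints W :=
    Affine.Point.map (W' := W.toAffine) (S := F) (Algebra.ofId F (AlgebraicClosure F)) with hι
  have hinj : Function.Injective ι :=
    Affine.Point.map_injective (W' := W.toAffine) (f := Algebra.ofId F (AlgebraicClosure F))
  have hNP : (N : ℤ) • P = 0 := by rw [natCast_zsmul, ← hP]; exact addOrderOf_nsmul_eq_zero P
  have hmem : ι P ∈ geomTorsion W N := by
    rw [mem_torsionBy_iff, ← map_zsmul, hNP, map_zero]
  refine ⟨⟨ι P, hmem⟩, rfl, fun h0 ↦ ?_, fun σ ↦ Subtype.ext ?_⟩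
  · have h : ι P = ι 0 := by rw [map_zero]; exact congrArg Subtype.val h0
    have hP0 : P = 0 := hinj h
    rw [hP0, addOrderOf_zero] at hP
    exact hN.one_lt.ne hP
  · let σ' : AlgebraicClosure F ≃ₐ[F] AlgebraicClosure F := σ
    have h1 := Affine.Point.map_map (W' := W.toAffine) (S := F)
      (Algebra.ofId F (AlgebraicClosure F)) (σ' : AlgebraicClosure F →ₐ[F] AlgebraicClosure F) P
    have h2 : (σ' : AlgebraicClosure F →ₐ[F] AlgebraicClosure F).comp
        (Algebra.ofId F (AlgebraicClosure F)) = Algebra.ofId F (AlgebraicClosure F) :=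
      Subsingleton.elim _ _
    rw [h2] at h1
    exact h1

/-- **`ρ̄_{E,N}` is reducible for an elliptic curve over a perfect field `F` (`N ≠ char F` prime) with
an `F`-rational point of order `N`**: the line spanned by its geometric point is `Γ_F`-stable and
`≠ ⊥, ⊤`. The tree's `not_hasIrreducibleModPGaloisRep_of_addOrderOf_eq` is the case `F = ℚ`.
[cite: Mazur1977, Ch. III §5, p. 157 (the Borel shape (1 *; 0 χ))] -/
theorem not_hasIrreducibleModPGaloisRep_of_rational_addOrderOf_eq [PerfectField F] [W.IsElliptic]
    {N : ℕ} [Fact N.Prime] [NeZero (N : F)] {P : W.toAffine.Point} (hP : addOrderOf P = N) :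
    ¬ W.HasIrreducibleModPGaloisRep N := by
  obtain ⟨Pb, -, hPb0, hfix⟩ := exists_geomTorsion_fixed_of_addOrderOf_eq W hP
  exact not_hasIrreducibleModPGaloisRep_of_smul_eq W N hPb0 hfix

end AnyField

end Literature.NumberTheory.EllipticCurves

/-- **(irr) ⇒ `E(F)[p] = 0`** over a perfect field `F` with `p ≠ char F`: if `ρ̄_{E,p}` is irreducible
then `E(F)` has no point of order `p`, i.e. every `F`-rational `Q` with `p • Q = 0` is `0`. This is the
hypothesis (h1) "`E(K)[p] = 0`" of Castella–Grossi–Skinner 2025, Thm. 6.5.2, as implied by BCS 2025's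
(irr_K) ("`ρ̄_g` is irreducible as `G_K`-representation", p. 7).
[cite: BurungaleCastellaSkinner2025, §4 (irr_K) (p. 7 of arXiv:2405.00270v2)]
[cite: Mazur1977, Ch. III §5, p. 157] -/
theorem WeierstrassCurve.HasIrreducibleModPGaloisRep.eq_zero_of_prime_smul_eq_zero
    {F : Type u} [Field F] [PerfectField F] {W : WeierstrassCurve F} [W.IsElliptic] {p : ℕ}
    [Fact p.Prime] [NeZero (p : F)] (h : W.HasIrreducibleModPGaloisRep p) (Q : W.toAffine.Point)
    (hQ : p • Q = 0) : Q = 0 := by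
  by_contra hQ0
  have hp : p.Prime := Fact.out
  have hord : addOrderOf Q = p := by
    rcases (Nat.dvd_prime hp).mp (addOrderOf_dvd_of_nsmul_eq_zero hQ) with h1 | h1
    · exact absurd (AddMonoid.addOrderOf_eq_one_iff.mp h1) hQ0
    · exact h1
  exact Literature.NumberTheory.EllipticCurves.not_hasIrreducibleModPGaloisRep_of_rational_addOrderOf_eq
    W hord h

/-! ## §2 BCS Thm. 4.2.1 (a) from CGS Thm. 6.5.2 on `p ∤ D_K` -/

namespace Literature.NumberTheory.EllipticCurves.BurungaleCastellaSkinner2025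

variable {N : ℕ} [NeZero N] {W : WeierstrassCurve ℚ} [W.IsGloballyMinimal] {K : Type u} [Field K]
  [NumberField K] {p : ℕ} [Fact p.Prime] {κ : ZpExtension K p} {γ : Field.absoluteGaloisGroup K}
  {jbar : AlgebraicClosure K →+* ℂ}

omit [NeZero N] in
/-- **The hypotheses of BCS Thm. 4.2.1 (a) (tree transcription) together with `p ∤ D_K` imply the
hypotheses of CGS Thm. 6.5.2**: (h1) `E(K)[p] = 0` comes from (irr_K)
(`HasIrreducibleModPGaloisRep.eq_zero_of_prime_smul_eq_zero`), ordinarity is definitional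
(`GoodOrd` = `IsOrdinaryAt`), and `p ∤ D_K` is the one §6 standing hypothesis of CGS that BCS do not
print. [cite: BurungaleCastellaSkinner2025, Thm. 4.2.1 and its proof ("Part (a) is contained in [CGS23, Thm. 5.5.2]", p. 8 of arXiv:2405.00270v2)]
[cite: CastellaGrossiSkinner2025, §6 standing hypotheses and Thm. 6.5.2] -/
theorem thm652Hypotheses_of_irr (hE : W.IsElliptic) (hN : N = W.conductorNorm ℤ) (hp2 : p ≠ 2)
    (hord : GoodOrd W p) (hK : IsImaginaryQuadratic K) (hodd : Odd (discr K)) (h3 : discr K ≠ -3)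
    (hHeeg : SatisfiesHeegnerHypothesis N K) (hirr : (W.baseChange K).HasIrreducibleModPGaloisRep p)
    (hh : ¬ p ∣ classNumber K) (hac : κ.IsAnticyclotomic) (hγ : κ.IsTopGenerator γ)
    (hpD : ¬ (p : ℤ) ∣ discr K) :
    CastellaGrossiSkinner2025.Thm652Hypotheses N W K p κ γ := by
  haveI := hE
  haveI : NeZero (p : K) := ⟨Nat.cast_ne_zero.mpr (Fact.out : p.Prime).ne_zero⟩
  exact
    { isElliptic := hE
      level := hN
      p_ne_two := hp2
      ordinary := (isOrdinaryAt_iff W p).mpr hord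
      isImaginaryQuadratic := hK
      not_dvd_discr := hpD
      noPTorsion := fun Q hQ ↦ hirr.eq_zero_of_prime_smul_eq_zero Q hQ
      heegner := hHeeg
      discr_odd := hodd
      discr_ne := h3
      not_dvd_classNumber := hh
      anticyclotomic := hac
      topGenerator := hγ }

omit [W.IsGloballyMinimal] in
/-- **CGS Thm. 6.5.2's conclusion implies BCS Thm. 4.2.1 (a)'s conclusion** on the data `(D, F, X)`:
from `ch(X_tor) = J²` and `J ∣ p^k · ch(𝔖/Λκ₁)` one gets `p^{2k} · ch(𝔖/Λκ₁)² ⊆ ch(X_tor)`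
(`(p^k ch(𝔖/Λκ₁))² = (J A)² = ch(X_tor) · A² ⊆ ch(X_tor)`). Pure ideal arithmetic in `Λ`.
[cite: BurungaleCastellaSkinner2025, Thm. 4.2.1 (a) (p. 8 of arXiv:2405.00270v2)]
[cite: CastellaGrossiSkinner2025, Thm. 6.5.2 (i)–(ii)] -/
theorem heegnerCharIdeal_sq_le_of_dvd (D : (W.baseChange K).LambdaAdicSelmerData κ γ)
    (F : HeegnerFamily N W K κ jbar) (X : (W.baseChange K).SelmerDualData κ γ)
    {J : Ideal (IwasawaAlgebra p)} {k : ℕ}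
    (hJ : Module.charIdeal (IwasawaAlgebra p) (Submodule.torsion (IwasawaAlgebra p) X.X) = J ^ 2)
    (hdvd : J ∣ Ideal.span {(p : IwasawaAlgebra p) ^ k} * heegnerCharIdeal D F) :
    ∃ c : ℤ_[p], c ≠ 0 ∧
      Ideal.span {(PowerSeries.C c : IwasawaAlgebra p)} * heegnerCharIdeal D F ^ 2 ≤
        Module.charIdeal (IwasawaAlgebra p) (Submodule.torsion (IwasawaAlgebra p) X.X) := by
  obtain ⟨A, hA⟩ := hdvd
  refine ⟨(p : ℤ_[p]) ^ (2 * k), pow_ne_zero _ (Nat.cast_ne_zero.mpr (Fact.out : p.Prime).ne_zero), ?_⟩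
  have hC : (PowerSeries.C ((p : ℤ_[p]) ^ (2 * k)) : IwasawaAlgebra p) =
      ((p : IwasawaAlgebra p) ^ k) ^ 2 := by
    rw [map_pow, map_natCast, pow_mul']
  rw [hC, ← Ideal.span_singleton_pow, ← mul_pow, hA, mul_pow, ← hJ]
  exact Ideal.mul_le_right

/-- **BCS 2025, Thm. 4.2.1 (a) is a corollary of CGS 2025, Thm. 6.5.2 wherever `p ∤ D_K`** — the
printed proof pointer "Part (a) is contained in [CGS23, Thm. 5.5.2]" made a kernel implication between
the two tree facts: `thm652_… → p ∤ D_K → thm421a_…`. (On the slice `p ∣ D_K` — `p` odd good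
ordinary ramified in `K` — the CGS statement does not apply and `thm421a_…` stands on BCS's word alone;
under (spl), e.g. in Thm. 1.2.2, `p` is unramified and this edge applies.) No new fact; net debt 0.
[cite: BurungaleCastellaSkinner2025, Thm. 4.2.1 (a) and its proof (p. 8 of arXiv:2405.00270v2)]
[cite: CastellaGrossiSkinner2025, Thm. 6.5.2 (= arXiv v1 Thm. 5.5.2) with §6 standing hypotheses (D_K prime to Np)] -/
theorem thm421a_of_thm652_of_not_dvd_discr
    (h : CastellaGrossiSkinner2025.thm652_rankOne_charIdeal_torsion_eq_sq_dvd N W K p κ γ jbar)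
    (hpD : ¬ (p : ℤ) ∣ discr K) :
    thm421a_rankOne_heegnerCharIdeal_sq_le_rat N W K p κ γ jbar := by
  intro hE hN hp2 hord hK hodd h3 hHeeg hirr hh hac hγ D F X
  have hyp := thm652Hypotheses_of_irr hE hN hp2 hord hK hodd h3 hHeeg hirr hh hac hγ hpD
  obtain ⟨hS, hXf, hXr, J, k, hJ, hdvd⟩ := h hyp D F X
  exact ⟨hS, ⟨hXf, hXr⟩, heegnerCharIdeal_sq_le_of_dvd D F X hJ hdvd⟩

/-- **Under the hypotheses of BCS Thm. 1.2.2 (`Thm122Hypotheses`, which include (spl)) and (irr_K),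
CGS Thm. 6.5.2 yields Thm. 4.2.1 (a)'s conclusion** — (spl) makes `p` unramified in `K`, i.e.
`p ∤ D_K`, which is taken here as the explicit arithmetic input `hpD` (the tree's
`ncard_primesOver = 2 ⇒ p ∤ D_K` is not invoked). [cite: BurungaleCastellaSkinner2025, Thm. 1.2.2 (data: (spl)) and Thm. 4.2.1 (a) (pp. 3, 8 of arXiv:2405.00270v2)]
[cite: CastellaGrossiSkinner2025, Thm. 6.5.2] -/
theorem thm421aConclusion_of_thm652_of_thm122Hypotheses
    (h : CastellaGrossiSkinner2025.thm652_rankOne_charIdeal_torsion_eq_sq_dvd N W K p κ γ jbar)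
    (hyp : Thm122Hypotheses N W K p κ γ) (hirr : (W.baseChange K).HasIrreducibleModPGaloisRep p)
    (hpD : ¬ (p : ℤ) ∣ discr K) (D : (W.baseChange K).LambdaAdicSelmerData κ γ)
    (F : HeegnerFamily N W K κ jbar) (X : (W.baseChange K).SelmerDualData κ γ) :
    (Module.Finite (IwasawaAlgebra p) D.S ∧ Module.finrank (IwasawaAlgebra p) D.S = 1) ∧
    (Module.Finite (IwasawaAlgebra p) X.X ∧ Module.finrank (IwasawaAlgebra p) X.X = 1) ∧
    ∃ c : ℤ_[p], c ≠ 0 ∧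
      Ideal.span {(PowerSeries.C c : IwasawaAlgebra p)} * heegnerCharIdeal D F ^ 2 ≤
        Module.charIdeal (IwasawaAlgebra p) (Submodule.torsion (IwasawaAlgebra p) X.X) :=
  thm421a_of_thm652_of_not_dvd_discr h hpD hyp.isElliptic hyp.level
    hyp.p_ne_two_and_discr_ne_neg_four.1 hyp.goodOrd hyp.isImaginaryQuadratic hyp.discr_odd
    hyp.discr_ne hyp.heegner hirr hyp.not_dvd_classNumber hyp.anticyclotomic hyp.topGenerator D F X

end Literature.NumberTheory.EllipticCurves.BurungaleCastellaSkinner2025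

end
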